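import Mathlib
import Summits.KontsevichZagierPeriods.Zeta5Search.DenomLaw.LawZL5
import Summits.KontsevichZagierPeriods.Zeta5Search.DenomLaw.ZeroCoverKit
import Summits.KontsevichZagierPeriods.Zeta5Search.ZeroPointWindows
import Summits.KontsevichZagierPeriods.Zeta5Search.DenomLaw.L5Depth8CoverKit
import Summits.KontsevichZagierPeriods.Zeta5Search.PalindromicClassBoundsProof
import HarnessLib

/-!
# ζ(5) search — a COVER KIT for THEOREM ZL5 at frame depth `M ≥ 8` in the ALL-PARAMETERS-LONG regime (`SecondOrder.lawZeroPointA5_depth8`, `9 − 2M`) — DENOM-LAW prover-d1 gen 22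

HONEST FRAMING: systematic search; no irrationality claim unless certified.  Cell `pub-zeta5`, track «DENOM-LAW», seat `denom-prover-d1`
gen 22 (`HOME/denom-law/prover-d1/ATTEMPT-22.md` §2).  `p`-adic valuation bookkeeping for the explicit rationals `Cas_j(b)` (Casoratians of the
Brown–Zudilin dual coefficients); nothing about ζ(5); no model exponent moves; records in print UNMOVED.

THEOREM ZL5 (gen 21, `DenomLaw/LawZL5.lean`: the ZERO-POINT law and THEOREM L5 in one frame `(M, T)` give `9 − 2M`) has two forms: `lawZeroPointA5`
(`M ≥ 10`) — wrapped for general-`b` profile theorems by gen 21's `DenomLaw/LawZL5CoverKit` (`zeroPointA5_of_cover`, which asks for ONE TYPED multipole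
class of exponent `≤ −M + 2`) — and `lawZeroPointA5_depth8` (`M ≥ 8`, PLUS «every single-pole class of `b` and of `b + e_j` has exponent `≥ −M + 4`»),
so far without a cover kit.  In the regime in which ALL SEVEN PARAMETERS REACH `p` (`p ≤ b_i`; the a = 7 profiles of the first period) both extra
inputs are AUTOMATIC:
* the single-pole side condition is gen 18's `neg_four_le_classExp_single_of_long` (`E ≥ −4 ≥ −M + 4`) for `b` and, by `long_shift`, for `b + e_j`;
* the multipole witness follows from the DEGREE CONDITION by pigeonhole (`exists_multipole_low_of_long`): `Σ_{x<p} E_x = −(2d + 5)`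
  (`ClusterValuation.exists_classExp_le_of_mul_lt`) and `p(M − 2) ≤ 2d + 1` give a class with `E_x ≤ −M + 2 ≤ −6`, which is neither pole-free
  (`E ≥ 0`, `classExp_nonneg_of_noPole`) nor single-pole (`E ≥ −4`), hence a multipole class.
Hence `zeroPointA5d8_of_classes_long` / `zeroPointA5d8_of_cover_long` / `cover_ZL5d8_long`: from a class-type cover of `b` passing gen 17's spelled-out
zero check (data `D`, `S`, `|D| + |S| ≤ 1`) and gen 3's six-clause check `DenomLaw.checkL5` in a frame `(M, T)` (`M ≥ 8` even, `T` a palindrome), the degree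
condition `p(M − 2) ≤ 2d(b) + 1` and `p ≤ b_i` for all `i`: **`9 − 2M ≤ v_p(Cas_j(b))`** for every admissible `j`.  No new definition.
MOTIVATION (ATTEMPT-22 §2): the `3p ≤ d` cells of the landed `N_p = 16` / `15` profile theorems (node `−7 = 9 − 16`, frame `(8, [1,−5,−5,1])`) and the
`4p ≤ d` corner of the full profile (node `−11 = 9 − 20`, frame `(10, [1,−6,−6,1])`), all left OPEN by gens 17–19, are this kit on the EXISTING covers.
-/

open Finset

namespace Summit.KontsevichZagierPeriods.Zeta5Search.DenomLaw

open Summit.KontsevichZagierPeriods.Zeta5Search.ClusterValuation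
open Summit.KontsevichZagierPeriods.Zeta5Search.CasoratianValuation (InPolytope shift casoratian)
open Summit.KontsevichZagierPeriods.Zeta5Search.WedgeDictionary (dOf)
open Summit.KontsevichZagierPeriods.Zeta5Search.ClassTypeCover
open Summit.KontsevichZagierPeriods.Zeta5Search.SecondOrder (classTypeList isRaise lawZeroPointA5_depth8 lawA4Classes_shift shapeClause_shift)
open Summit.KontsevichZagierPeriods.Zeta5Search.ZeroWindows (ZeroWindowClasses point_eq_of_classes)
open Summit.KontsevichZagierPeriods.Zeta5Search.ResidueLaw (sum_classExp_range pointW pointV liveClasses)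
open Summit.KontsevichZagierPeriods.Zeta5Search.RecordWindowsA4 (LawA4Classes)
open Summit.KontsevichZagierPeriods.Zeta5Search.SecondResidueLaw (ShapeClause)

variable {p : ℕ}

/-! ## §1 The multipole witness from the degree condition -/

/-- **In the all-parameters-long regime the degree condition supplies a low multipole class**: `p ≤ b_i` for all `i`, `7 ≤ M` and
`p(M − 2) ≤ 2d(b) + 1` give a class with at least two poles and exponent `≤ −M + 2` (pigeonhole on `Σ_{x<p} E_x = −(2d+5)`; a class with
`E ≤ −5` is neither pole-free nor, all parameters long, single-pole). -/
theorem exists_multipole_low_of_long [Fact p.Prime] {b : ℕ → ℤ} (hb : InPolytope b) (hp5 : 5 ≤ p)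
    (hlong : ∀ i ∈ range 7, (p : ℤ) ≤ b (i + 1)) {M : ℕ} (hM : 7 ≤ M) (hdeg : (p : ℤ) * ((M : ℤ) - 2) ≤ 2 * dOf b + 1) :
    ∃ x, x < p ∧ 2 ≤ classPoleCount b p x ∧ classExp b p x ≤ -(M : ℤ) + 2 := by
  have hp5' : (5 : ℤ) ≤ p := by exact_mod_cast hp5
  have hcast : ((M - 3 : ℕ) : ℤ) = (M : ℤ) - 3 := by
    rw [Nat.cast_sub (by omega : 3 ≤ M)]; push_cast; ring
  have h : ((M - 3 : ℕ) : ℤ) * p < 2 * dOf b + 5 := by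
    rw [hcast]; linarith
  obtain ⟨x, hx, hE⟩ := exists_classExp_le_of_mul_lt b hb hp5 (M - 3) h
  rw [hcast] at hE
  refine ⟨x, hx, ?_, by omega⟩
  by_contra hlt
  rcases Nat.le_one_iff_eq_zero_or_eq_one.1 (by omega : classPoleCount b p x ≤ 1) with h0 | h1
  · have := classExp_nonneg_of_noPole b h0; omega
  · have := neg_four_le_classExp_single_of_long hb hp5 hlong hx h1; omega

/-! ## §2 THEOREM ZL5 at depth `M ≥ 8` from the class structure / from a cover, all parameters long -/

/-- **THEOREM ZL5₈ from the class structure, all parameters long**: `ZeroWindowClasses b p M D S` with palindromic `D`, `|D| + |S| ≤ 1`, the degree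
condition `p(M − 2) ≤ 2d + 1`, THEOREM L5's six clauses for `b` in the frame `(M, T)` (`M ≥ 8` even, `T` a palindrome; the clauses for `b + e_j` by
transport) and `p ≤ b_i` for every `i` give `9 − 2M ≤ v_p(Cas_j(b))` (the single-pole side condition and the multipole witness of
`lawZeroPointA5_depth8` are discharged by §1 and gen 18's `neg_four_le_classExp_single_of_long`). -/
theorem zeroPointA5d8_of_classes_long {b : ℕ → ℤ} {j : ℕ} (hb : InPolytope b) (hb' : InPolytope (shift b j)) (hj1 : 1 ≤ j) (hj7 : j ≤ 7)
    (hpr : p.Prime) (hp5 : 5 ≤ p) (hpb : (p : ℤ) ≤ b 0) (hwin : (b 0 + 2 : ℤ) < (p : ℤ) ^ 2)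
    (hlong : ∀ i ∈ range 7, (p : ℤ) ≤ b (i + 1))
    {M : ℕ} (hM : 8 ≤ M) (hMe : Even M) {D S : List (List ℤ)} (hD : ∀ T ∈ D, T.reverse = T) (hlen : D.length + S.length ≤ 1)
    (hC : ZeroWindowClasses b p M D S) (hdeg : (p : ℤ) * ((M : ℤ) - 2) ≤ 2 * dOf b + 1)
    {T : List ℤ} (hT : T.reverse = T) (hL : LawA4Classes b p M T) (hSh : ShapeClause b p M T)
    (hcas : casoratian b j ≠ 0) : (9 : ℤ) - 2 * M ≤ padicValRat p (casoratian b j) := by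
  haveI : Fact p.Prime := ⟨hpr⟩
  have hdeg' : (p : ℤ) * ((M : ℤ) - 2) + ∑ x ∈ range p, classExp b p x ≤ -4 := by
    rw [sum_classExp_range b hb hp5]; omega
  have G3 : ∀ x, x < p → 1 ≤ classPoleCount b p x → classExp b p x = -(M : ℤ) →
      ¬ CentreIn b p x ∧ (classTypeList b p x).reverse = classTypeList b p x :=
    fun x hx h1 hE => ⟨(hC.2.1 x hx h1 hE).1, hD _ (hC.2.1 x hx h1 hE).2⟩
  have hL' := lawA4Classes_shift b hb hb' hj1 hj7 hpb (by omega) hL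
  have hSh' := shapeClause_shift b hb hb' hj1 hj7 hpb (by omega) hL hSh
  have hsing : ∀ y, y < p → classPoleCount b p y = 1 → -(M : ℤ) + 4 ≤ classExp b p y := fun y hy h1 => by
    have := neg_four_le_classExp_single_of_long hb hp5 hlong hy h1; omega
  have hsing' : ∀ y, y < p → classPoleCount (shift b j) p y = 1 → -(M : ℤ) + 4 ≤ classExp (shift b j) p y := fun y hy h1 => by
    have := neg_four_le_classExp_single_of_long hb' hp5 (long_shift hlong) hy h1; omega
  have hlow := exists_multipole_low_of_long hb hp5 hlong (by omega : 7 ≤ M) hdeg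
  refine lawZeroPointA5_depth8 b p j M T hb hb' hj1 hj7 hpr hp5 hpb hwin hM hMe hC.1 G3 hdeg' ?_ hT hL hL' hSh hSh' hsing hsing'
    hlow hcas
  intro x hx y hy
  obtain ⟨hW, hV⟩ := point_eq_of_classes b hb hpb (by omega) hMe hD hC hlen hx hy
  exact ⟨Or.inl (by rw [hW, sub_self]), Or.inl (by rw [hV, sub_self])⟩

/-- **THEOREM ZL5₈ from a cover of `b` alone, all parameters long**: gen 17's zero-point check (`DenomLaw.zeroClasses_of_cover`, data `D`, `S` with
`|D| + |S| ≤ 1`), gen 3's six-clause check `DenomLaw.checkL5` in the frame `(M, T)` (`M ≥ 8` even, `T` a palindrome), the degree condition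
`p(M − 2) ≤ 2d(b) + 1` and `p ≤ b_i` for all `i` give `9 − 2M ≤ v_p(Cas_j(b))`.  Both checks are spelled out as `List.all` (no new definition). -/
theorem zeroPointA5d8_of_cover_long {b : ℕ → ℤ} {j : ℕ} (hb : InPolytope b) (hb' : InPolytope (shift b j)) (hj1 : 1 ≤ j) (hj7 : j ≤ 7)
    (hpr : p.Prime) (hp5 : 5 ≤ p) (hpb : (p : ℤ) ≤ b 0) (hwin : (b 0 + 2 : ℤ) < (p : ℤ) ^ 2)
    (hlong : ∀ i ∈ range 7, (p : ℤ) ≤ b (i + 1))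
    {TY : List (List ℤ × Bool)} (hcov : Cover b p TY) {M : ℕ} (hM : 8 ≤ M) (hMe : Even M)
    {D S : List (List ℤ)} (hD : ∀ T ∈ D, T.reverse = T) (hlen : D.length + S.length ≤ 1)
    (hchkZ : (TY.all fun tc =>
      decide (polesL tc.1 = 0) ||
      ((decide (-(M : ℤ) ≤ expL (decide (¬ (2 : ℤ) ∣ b 0)) tc.1 tc.2) &&
        (!decide (expL (decide (¬ (2 : ℤ) ∣ b 0)) tc.1 tc.2 = -(M : ℤ)) || (!tc.2 && decide (tc.1 ∈ D)))) &&
        (!decide (expL (decide (¬ (2 : ℤ) ∣ b 0)) tc.1 tc.2 = -(M : ℤ) + 1) ||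
          (D.any (fun T => isRaise T tc.1 || (decide (¬ (2 : ℤ) ∣ b 0) && tc.2 && decide (tc.1 = T))) ||
            (!tc.2 && (decide (tc.1 ∈ S) || decide (tc.1.reverse ∈ S))))))) = true)
    (hdeg : (p : ℤ) * ((M : ℤ) - 2) ≤ 2 * dOf b + 1) {T : List ℤ} (hT : T.reverse = T)
    (hchkL : checkL5 (decide (¬ (2 : ℤ) ∣ b 0)) TY M T = true)
    (hcas : casoratian b j ≠ 0) : (9 : ℤ) - 2 * M ≤ padicValRat p (casoratian b j) := by
  haveI : Fact p.Prime := ⟨hpr⟩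
  obtain ⟨hL, hSh⟩ := clausesL5_of_cover hcov hchkL
  exact zeroPointA5d8_of_classes_long hb hb' hj1 hj7 hpr hp5 hpb hwin hlong hM hMe hD hlen (zeroClasses_of_cover hb.1.1 hcov hchkZ)
    hdeg hT hL hSh hcas

/-- **WINDOW BOUND by THEOREM ZL5₈ from a cover, all parameters long**: `c ≤ v_p(Cas_j(b))` whenever `c ≤ 9 − 2M`. -/
theorem cover_ZL5d8_long {b : ℕ → ℤ} {j : ℕ} (hb : InPolytope b) (hb' : InPolytope (shift b j)) (hj1 : 1 ≤ j) (hj7 : j ≤ 7)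
    (hpr : p.Prime) (hp5 : 5 ≤ p) (hpb : (p : ℤ) ≤ b 0) (hwin : (b 0 + 2 : ℤ) < (p : ℤ) ^ 2)
    (hlong : ∀ i ∈ range 7, (p : ℤ) ≤ b (i + 1))
    {TY : List (List ℤ × Bool)} (hcov : Cover b p TY) {M : ℕ} (hM : 8 ≤ M) (hMe : Even M)
    {D S : List (List ℤ)} (hD : ∀ T ∈ D, T.reverse = T) (hlen : D.length + S.length ≤ 1)
    (hchkZ : (TY.all fun tc =>
      decide (polesL tc.1 = 0) ||
      ((decide (-(M : ℤ) ≤ expL (decide (¬ (2 : ℤ) ∣ b 0)) tc.1 tc.2) &&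
        (!decide (expL (decide (¬ (2 : ℤ) ∣ b 0)) tc.1 tc.2 = -(M : ℤ)) || (!tc.2 && decide (tc.1 ∈ D)))) &&
        (!decide (expL (decide (¬ (2 : ℤ) ∣ b 0)) tc.1 tc.2 = -(M : ℤ) + 1) ||
          (D.any (fun T => isRaise T tc.1 || (decide (¬ (2 : ℤ) ∣ b 0) && tc.2 && decide (tc.1 = T))) ||
            (!tc.2 && (decide (tc.1 ∈ S) || decide (tc.1.reverse ∈ S))))))) = true)
    (hdeg : (p : ℤ) * ((M : ℤ) - 2) ≤ 2 * dOf b + 1) {T : List ℤ} (hT : T.reverse = T)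
    (hchkL : checkL5 (decide (¬ (2 : ℤ) ∣ b 0)) TY M T = true)
    {c : ℤ} (hc : c ≤ 9 - 2 * (M : ℤ)) (hcas : casoratian b j ≠ 0) : c ≤ padicValRat p (casoratian b j) :=
  le_trans hc (zeroPointA5d8_of_cover_long hb hb' hj1 hj7 hpr hp5 hpb hwin hlong hcov hM hMe hD hlen hchkZ hdeg hT hchkL hcas)

/-- Sanity of the zero-point check at `(8; [[1,−5,−5,1]], [])` on the live types of the `N_p = 16` branch `(1,2),…,(1,6)` at `3p ≤ d`, odd `b₀`
(deep `[1,−5,−5,1]` at `−8`, its two single raises and its centred copy at `−7`; the tame singles `[1,−6,1]`, `[1,0,−6,0,1]`) — exact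
`v₇(Cas₇) = −7 = 9 − 2M` on `b = (27; 13, 8, 8, 8, 8, 8, 7)`, `p = 7` (node `−7`, L5₈ `−8`). -/
example : (([([1, -5, -5, 1], false), ([1, -4, -5, 1], false), ([1, -5, -4, 1], false), ([1, -5, -5, 1], true), ([1, -6, 1], false),
      ([1, 0, -6, 0, 1], false)] : List (List ℤ × Bool)).all fun tc =>
      decide (polesL tc.1 = 0) ||
      ((decide (-((8 : ℕ) : ℤ) ≤ expL true tc.1 tc.2) &&
        (!decide (expL true tc.1 tc.2 = -((8 : ℕ) : ℤ)) || (!tc.2 && decide (tc.1 ∈ ([[1, -5, -5, 1]] : List (List ℤ)))))) &&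
        (!decide (expL true tc.1 tc.2 = -((8 : ℕ) : ℤ) + 1) ||
          (([[1, -5, -5, 1]] : List (List ℤ)).any (fun T => isRaise T tc.1 || (true && tc.2 && decide (tc.1 = T))) ||
            (!tc.2 && (decide (tc.1 ∈ ([] : List (List ℤ))) || decide (tc.1.reverse ∈ ([] : List (List ℤ))))))))) = true := by
  decide

/-- … and of the six-clause L5 check on the same types in the frame `(8, [1,−5,−5,1])`. -/
example : checkL5 true [([1, -5, -5, 1], false), ([1, -4, -5, 1], false), ([1, -5, -4, 1], false), ([1, -5, -5, 1], true), ([1, -6, 1], false),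
      ([1, 0, -6, 0, 1], false)] 8 [1, -5, -5, 1] = true := by
  decide

end Summit.KontsevichZagierPeriods.Zeta5Search.DenomLaw
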